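import Literature.AlgebraicGeometry.HodgeTheory.ChernCharacterCoherent
import Literature.AlgebraicGeometry.KTheory.CoherentGrothendieckGroupRegular
import Literature.AlgebraicGeometry.Modules.BoundedCoherentVBModelsProjective
import HarnessLib

/-!
# The resolution-free Chern character `ch_k(F)` of a coherent sheaf on a regular complex variety

For a complex variety `X` (a `SchemeOver ℂ`) whose underlying scheme is noetherian, integral, separated and
regular (the standing hypotheses of Hartshorne III Ex. 6.9; e.g. a smooth projective variety), a Chern character
`C : ChernCharacterBetti` (`HodgeTheory/ChernCharacterBetti`) and a coherent sheaf `F`, the Chern character is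
defined WITHOUT choosing a resolution as `ch_k(F) := ch_k(δ[F])`, `δ[F] = KZero.ofCoh' hX F hF ∈ K₀(X)` the
resolution-free class of `KTheory/CoherentGrothendieckGroupRegular` (Hartshorne III Ex. 6.9 (b): `δ : K(X) ≅ K_1(X)`)
and `ch_k : K₀(X) →+ H^{2k}(X(ℂ); ℂ)` the additive extension (`chKZero`,
`HodgeTheory/SemiregularVariationalHodgeTwistedPerfect`). Fulton, *Intersection Theory*, §15.1 (p. 282), the Chern
character "`ch : K⁰X → A(X)_ℚ`" on classes, with Example 15.1.5 / App. B.8.3 and, for non-singular `X`, `K⁰X ≅ K₀X`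
(Thm. 15.1 / III Ex. 6.9), so that `ch` is defined on coherent sheaves; Hartshorne App. A §3–§4.

* `chCoh' C X hX F hF k := chKZero C X k (KZero.ofCoh' hX F hF)` — ONE definition;
* PROVED, hypothesis-free: `chCoh'_eq_chCoh` (**it agrees with the tree's `chCoh C X F R k` on EVERY finite locally
  free resolution `R`**, `HodgeTheory/ChernCharacterCoherent`), `chCoh'_shortExact` (**additivity on short exact
  sequences of coherent sheaves**), `chCoh'_eq_ch` (a vector bundle), `chCoh'_congr`, `chCoh'_eq_zero_of_isZero`,
  `chCoh'_pushforward_unit_eq ∕ chCoh'_idealSheafOf_eq` (**`ch_k(𝓘_Z) = ch_k(𝒪_X) − ch_k(ι_*𝒪_Z)`** for a closed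
  immersion `ι : Z → X`), `isRationalClass_chCoh'`, and on a smooth projective `X` (`Modules.IsSmoothProjective.isRegular`,
  `Modules/BoundedCoherentVBModelsProjective`) `chCoh'_mem_algebraicClasses`.

The instance hypotheses `[IsNoetherian X.left] [IsIntegral X.left] [X.left.IsSeparated]` are those of
`KZero.ofCoh'`; for a smooth projective variety they hold by properness over `ℂ` and geometric integrality
(`Motives.IsSmoothProjective.isProper_holds ∕ isIntegral_holds`), and `Scheme.IsRegular X.left` is
`Modules.IsSmoothProjective.isRegular`. No named fact, no instance, no notation; `ChernCharacterCoherent(SmoothProjective)`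
and every consumer of `chCoh` are unchanged (this file only adds the resolution-free variant).

## References

* W. Fulton, *Intersection Theory*, 2nd ed. (1998), §15.1 (p. 282), Example 15.1.5, App. B.8.3. [Fulton1998]
* R. Hartshorne, *Algebraic Geometry*, GTM 52 (1977), III Ex. 6.9 (b) (p. 239), App. A §3. [Hartshorne1977]
-/

noncomputable section

open CategoryTheory CategoryTheory.Limits AlgebraicGeometry
open Literature.AlgebraicGeometry.KTheory

namespace Literature.AlgebraicGeometry.HodgeTheory

open Literature.AlgebraicGeometry.Motives Literature.AlgebraicGeometry.Modules
  Literature.AlgebraicGeometry.Morphisms Literature.AlgebraicGeometry.Resolution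
open Literature.AlgebraicGeometry.KTheory.Adapted (coh_of_isFiniteLocallyFree)

section ResolutionFree

variable (C : ChernCharacterBetti) (X : SchemeOver ℂ) [IsNoetherian X.left] [IsIntegral X.left] [X.left.IsSeparated]

/-- **The resolution-free Chern character of a coherent sheaf**, degree `k`: `ch_k(F) := ch_k(δ[F])` with
`δ[F] = KZero.ofCoh' hX F hF ∈ K₀(X)` the resolution-free class (Hartshorne III Ex. 6.9 (b)) and `ch_k : K₀(X) → H^{2k}`
the additive Chern character (`chKZero`). It equals `chCoh C X F R k` for every finite locally free resolution `R`
(`chCoh'_eq_chCoh`). [cite: Fulton1998, §15.1 (p. 282) with App. B.8.3] [cite: Hartshorne1977, III Ex. 6.9 (b) (p. 239)] -/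
def chCoh' (hX : Scheme.IsRegular X.left) (F : X.left.Modules) (hF : Coh F) (k : ℕ) : complexBetti X (2 * k) :=
  chKZero C X k (KZero.ofCoh' hX F hF)

/-- Unfolding. [cite: Fulton1998, §15.1 (p. 282)] -/
theorem chCoh'_def (hX : Scheme.IsRegular X.left) (F : X.left.Modules) (hF : Coh F) (k : ℕ) :
    chCoh' C X hX F hF k = chKZero C X k (KZero.ofCoh' hX F hF) := rfl

variable {X}

/-- **`ch_k(F)` is computed by ANY finite locally free resolution**: `chCoh' C X hX F hF k = chCoh C X F R k`
(`KZero.ofCoh'_eq_ofCoh`). [cite: Fulton1998, §15.1 (p. 282) with App. B.8.3 (v)] [cite: Hartshorne1977, III Ex. 6.9 (b) (p. 239)] -/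
theorem chCoh'_eq_chCoh (hX : Scheme.IsRegular X.left) {F : X.left.Modules} (hF : Coh F)
    (R : StrictlyPerfectResolution F) (k : ℕ) : chCoh' C X hX F hF k = chCoh C X F R k := by
  rw [chCoh'_def, chCoh_def, KZero.ofCoh'_eq_ofCoh hX hF R]

/-- **Additivity of `ch_k` on short exact sequences of coherent sheaves**: `ch_k(F₂) = ch_k(F₁) + ch_k(F₃)`.
[cite: Fulton1998, §15.1 (p. 282) with App. B.8.3 (iii)] [cite: Hartshorne1977, III Ex. 6.9 (b) (p. 239)] -/
theorem chCoh'_shortExact (hX : Scheme.IsRegular X.left) {S : ShortComplex X.left.Modules} (hS : S.ShortExact)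
    (h₁ : Coh S.X₁) (h₂ : Coh S.X₂) (h₃ : Coh S.X₃) (k : ℕ) :
    chCoh' C X hX S.X₂ h₂ k = chCoh' C X hX S.X₁ h₁ k + chCoh' C X hX S.X₃ h₃ k := by
  simp only [chCoh'_def, KZero.ofCoh'_shortExact hX hS h₁ h₂ h₃, map_add]

/-- **`ch_k` of a vector bundle is `C.ch`.** [cite: Fulton1998, §15.1 (p. 282)] -/
theorem chCoh'_eq_ch (hX : Scheme.IsRegular X.left) {E : X.left.Modules} (hE : IsFiniteLocallyFree E) (hE' : Coh E)
    (k : ℕ) : chCoh' C X hX E hE' k = C.ch X E k := by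
  rw [chCoh'_def, KZero.ofCoh'_of_isFiniteLocallyFree hX hE hE', chKZero_of]

/-- The proof of coherence does not matter. [cite: Fulton1998, §15.1 (p. 282)] -/
theorem chCoh'_congr_prop (hX : Scheme.IsRegular X.left) {F : X.left.Modules} (hF hF' : Coh F) (k : ℕ) :
    chCoh' C X hX F hF k = chCoh' C X hX F hF' k := rfl

/-- Isomorphic coherent sheaves have the same Chern character. [cite: Fulton1998, §15.1 (p. 282)] -/
theorem chCoh'_congr (hX : Scheme.IsRegular X.left) {F F' : X.left.Modules} (e : F ≅ F') (hF : Coh F) (hF' : Coh F')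
    (k : ℕ) : chCoh' C X hX F hF k = chCoh' C X hX F' hF' k := by
  rw [chCoh'_def, chCoh'_def, KZero.ofCoh'_congr hX e hF hF']

/-- `ch_k` of a zero sheaf vanishes. [cite: Fulton1998, §15.1 (p. 282)] -/
theorem chCoh'_eq_zero_of_isZero (hX : Scheme.IsRegular X.left) {F : X.left.Modules} (hF : IsZero F) (hF' : Coh F)
    (k : ℕ) : chCoh' C X hX F hF' k = 0 := by
  rw [chCoh'_def, KZero.ofCoh'_eq_zero_of_isZero hX hF hF', map_zero]

/-- **`ch_k(ι_*𝒪_Z) = ch_k(𝒪_X) − ch_k(𝓘_Z)`** for a closed immersion `ι : Z → X` (additivity on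
`0 → 𝓘_Z → 𝒪_X → ι_*𝒪_Z → 0`, `Modules/IdealSheafOfClosedImmersion.shortExact_idealSheafOf`).
[cite: Fulton1998, Example 15.1.5] [cite: Hartshorne1977, III Ex. 6.9 (b) (p. 239) with II Prop. 5.9] -/
theorem chCoh'_pushforward_unit_eq (hX : Scheme.IsRegular X.left) {Z : Scheme.{0}} (ι : Z ⟶ X.left)
    [IsClosedImmersion ι] (k : ℕ) :
    chCoh' C X hX ((Scheme.Modules.pushforward ι).obj (unitModule Z)) (coh_pushforward_unit ι) k =
      C.ch X (unitModule X.left) k - chCoh' C X hX (idealSheafOf ι) (coh_idealSheafOf ι) k := by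
  rw [eq_sub_iff_add_eq', ← chCoh'_eq_ch C hX isFiniteLocallyFree_unitModule (coh_of_isFiniteLocallyFree
    isFiniteLocallyFree_unitModule) k]
  exact (chCoh'_shortExact C hX (shortExact_idealSheafOf ι) (coh_idealSheafOf ι)
    (coh_of_isFiniteLocallyFree isFiniteLocallyFree_unitModule) (coh_pushforward_unit ι) k).symm

/-- **`ch_k(𝓘_Z) = ch_k(𝒪_X) − ch_k(ι_*𝒪_Z)`** (rearranged). [cite: Fulton1998, Example 15.1.5] [cite: Hartshorne1977, III Ex. 6.9 (b) (p. 239) with II Prop. 5.9] -/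
theorem chCoh'_idealSheafOf_eq (hX : Scheme.IsRegular X.left) {Z : Scheme.{0}} (ι : Z ⟶ X.left)
    [IsClosedImmersion ι] (k : ℕ) :
    chCoh' C X hX (idealSheafOf ι) (coh_idealSheafOf ι) k =
      C.ch X (unitModule X.left) k - chCoh' C X hX ((Scheme.Modules.pushforward ι).obj (unitModule Z))
        (coh_pushforward_unit ι) k := by
  rw [chCoh'_pushforward_unit_eq C hX ι k, sub_sub_cancel]

/-- `ch_k(F)` is a rational class. [cite: VoisinHodgeI2002, Thm. 11.23] -/
theorem isRationalClass_chCoh' (hX : Scheme.IsRegular X.left) (F : X.left.Modules) (hF : Coh F) (k : ℕ) :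
    IsRationalClass (chCoh' C X hX F hF k) :=
  isRationalClass_chKZero C X k _

/-- `ε(δ[F]) = [F]`: the class underlying `ch_k(F)` maps to `[F] ∈ K(X)` (bookkeeping link with
`KTheory/CoherentGrothendieckGroup`). [cite: Hartshorne1977, III Ex. 6.9 (b) (p. 239)] -/
theorem toKZeroCoh_ofCoh'_eq (hX : Scheme.IsRegular X.left) (F : X.left.Modules) (hF : Coh F) :
    KZero.toKZeroCoh (KZero.ofCoh' hX F hF) = KZeroCoh.of F hF :=
  KZero.toKZeroCoh_ofCoh' hX F hF

/-- **On a smooth projective complex variety, `ch_k(F)` is an ALGEBRAIC class** (with `Modules.IsSmoothProjective.isRegular hX` as the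
regularity input). [cite: Fulton1998, Prop. 19.1.2 and Cor. 19.2 (b)] -/
theorem chCoh'_mem_algebraicClasses {n : ℕ} (hX : IsSmoothProjective n X) (F : X.left.Modules) (hF : Coh F)
    (k : ℕ) : chCoh' C X (Modules.IsSmoothProjective.isRegular hX) F hF k ∈ algebraicClasses X k :=
  chKZero_mem_algebraicClasses C X hX k _

/-- On a smooth projective complex variety, `ch_k(F)` agrees with `chCoh` on any resolution (regularity by
`IsSmoothProjective.isRegular`). [cite: Fulton1998, §15.1 (p. 282) with App. B.8.3 (v)] -/
theorem chCoh'_eq_chCoh_of_isSmoothProjective {n : ℕ} (hX : IsSmoothProjective n X) {F : X.left.Modules}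
    (hF : Coh F) (R : StrictlyPerfectResolution F) (k : ℕ) :
    chCoh' C X (Modules.IsSmoothProjective.isRegular hX) F hF k = chCoh C X F R k :=
  chCoh'_eq_chCoh C (Modules.IsSmoothProjective.isRegular hX) hF R k

end ResolutionFree

end Literature.AlgebraicGeometry.HodgeTheory

end
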